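import Literature.MathematicalPhysics.QuantumFieldTheory.Balaban1983to89.B15Claim189ChiOmega4Pin

/-!
# `Balaban1983to89.B15Claim189ZppOfRecordPin` — YM-DAG node N12 · [Balaban1989LargeFieldI] CMP **122** (1989) 175–202, (1.10)–(1.11) p. 179: THE INTERPOLATED NEW LARGE-FIELD
# REGIONS `Z″_{k−1}, …, Z″_{k₀+2}` OF THE (1.89) SITUATION — module 13's residual family `Zres` — PINNED TO lit-balaban's TORUS LARGE-FIELD REGIONS OF RECORD
# (`B15Eq112TorusCover.ZppT`, print's completion CONSTRUCTED and (1.12)'s admissibility PROVED on the universal cover by `B15Eq112Admissible`); THE COVER BRIDGE for def-T's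
# layer enlargement `hullD`; and the identification: the situation's `Z″_j`, `j > h`, ARE those torus regions of record

statement-level bookkeeping over published theorems with citation tags; kernel-checked compositions of tree theorems; nothing here is a claim about the Yang–Mills
mass gap.

CITATION HEADER (lean-in-tree rule).  Source: [Balaban1989LargeFieldI] («[IV]»; page image `…-p005-x2.png` re-read by this seat), p. 179, verbatim: *"Define Z″_k = (Z′_{k−N₀})^{∼3} =
(Ω^{∼5}_{k−N₀+1})ᶜ ∩ Z, Z″_{k−N₀+1} = (Z′_{k−N₀})^∼ = (Ω^{∼7}_{k−N₀+1})ᶜ ∩ Z, (1.10) and complete these two sets to a sequence Z″_k, Z″_{k−1}, …, Z″_{k−N₀+2}, Z″_{k−N₀+1} in such a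
way that the complements of these sets form an admissible sequence of domains based on partitions into M-cubes in the corresponding scales. Thus Z″_k, Z″_k∖Z″_{k−1} are unions of
M-cubes of the lattice T_η, and Z″ᶜ_k, Z″_{k−1} are separated by one layer of M-cubes. Similarly, Z″_{k−1}, Z″_{k−1}∖Z″_{k−2} are unions of L^{−1}M-cubes of this lattice, and Z″ᶜ_{k−1},
Z″_{k−2} are separated by one layer of L^{−1}M-cubes, and so on. Next, define Z″_j = (Ω_j^{∼5})ᶜ ∩ Z for j = k − N₀, k − N₀ − 1, …, k − N + 1 = h + 1, Z″_j = Z_j for j = h, h − 1, …, 1.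
(1.11) This is the new sequence of the large field regions. We define new domains Ω″_j by Ω″_j = (Z″ᶜ_j ∩ Z) ∪ (Ω_j ∩ Zᶜ) for j = k, k − 1, …, h + 1, Ω″_j = Ω_j for j = h, h − 1, …, 1. (1.12)
The sequence {Ω″_j} is an admissible sequence"*; p. 179: *"the domains Ω_j^{∼n} are unions of L^{−(k−j)}MR_j-cubes of the lattice T_η"*; (1.19)–(1.21) pp. 180–181 (the determining sets
`𝔹_k^{(n)}(Z)` and `U″_{k,Z}` READ the sequence `Z″_j`).  [Balaban1988Convergent] («[III]») (2.1) p. 254, (2.5) p. 255, (2.13) p. 256, (2.16)–(2.17) p. 257, p. 264–265; [Balaban1987RG1]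
(0.1) p. 251 (the torus).  Seat `pub-ymgap-dag-n12-e` (YM-PLAN Track A, HUMAN RULING D-0062; director-ym R134 row N12 s3), generation 7, module 19.  BY NAME and UNCHANGED: lit-balaban
p29 g14 `B15Eq112Admissible` (`completion`, `completion_top ∕ _bot`, `Zpp`, `zpp_of_le ∕ _lt`, `Hypotheses`, `Admissible`), p29 g17 `B15Eq112TorusCover` (`cover`, `lift`, `per`,
`cover_lift`, `cover_eq_cover_iff`, `cover_add_pmul`, `image_preimage`, `ZppC`, `ZppT`, `pullSeq`, `zppT_subset ∕ _mono ∕ _disjoint`, `Z_diff_zppT_subset`, `admissible_record`), p29 g13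
`B15LatticeCubeTorus` (`pmul`, `cubeIdx_sub_pmul`), pv02 `B14DomainGeom` (`Pt`, `cubeIdx`, `cubeIdx_le`, `IdxNear`, `enl`), b02 `B16Stage3Regions` (`farZ`, `Zk`, `Zk0`), r11
`B14.Eq213MaximalDomains` (`side`, `cubeExt`), r12 `B15DeterminingSets.omegaPP` (the (1.12) display on the torus), def-T's `Node00.hullD`, def-R's `Node00.cubeIndices ∕ cubeEnl ∕
dCubeSide ∕ RkOfRecord`, module 11 (`omegaOfChain`), module 13 (`zppOfChain` + `_mid ∕ _k₀succ ∕ _top`, `Sit189.pinZpp`), module 14 (`D189OfHist`, `sitOfHist`), module 15 (`cubeOfSite`,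
`cubeOfSite_mem_cubeIndices`, `mem_cubeEnl_cubeOfSite`, `lift_lt_mul_cubeIdx_add`, `Sit189.pinCubes ∕ pinDistAt`), module 16 (`enlD`, `enlD_apply`, `dCubeSide_pos`, `Sit189.pinLambda`,
`claim189_sitOfHist_Λ_of_flow`), module 17 (`Sit189.pinSides ∕ pinOmegaPP`), module 18 (`Sit189.pinXΩ4`, `claim189_sitOfHist_ΛΩχ_of_flow`, `claim189_sitOfHist₁₃_ΛΩχ_of_inInterval`).

WHY THIS FILE.  After modules 13 ∕ 16 ∕ 17 ∕ 18 every region letter of the (1.89) situation at the record is an object of record EXCEPT the component union `Z` (a (1.99) summation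
variable: term data) and the INTERPOLATED members `Z″_j`, `k₀ + 2 ≤ j ≤ k − 1`, of (1.10) — module 13's `zppOfChain` took them as a residual family `Zres` (print: *«complete these two
sets … in such a way that»*).  These members are NOT decorative: the configuration `U″_{k,Z}` of (1.21) — the subject of (1.89) — reads EVERY `Z″_j`, `h < j ≤ k`, through the
determining sets (1.14)–(1.19).  Print's completion EXISTS IN THE TREE: lit-balaban p29 constructed it on the universal cover `ℤᵈ` (`B15Eq112Admissible.completion`: `E_k = Z″ᶜ_k`,
`E_j = E_{j+1}` plus one layer of `s_{j+1}`-cubes, `E_{k₀+1} = Z″ᶜ_{k₀+1}`; the geometric sum fits into the two layers `Ω^{∼7}∖Ω^{∼5}`), PROVED *«{Ω″_j} is an admissible sequence»*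
(`Hypotheses.admissible_omegaPP_completion`), and descended the sequence to the torus of record (`B15Eq112TorusCover.ZppT`, the *torus large-field regions of record*, deck
invariance `zppC_inter_deck`).  THIS FILE (§2) pins `Zres :=` that torus sequence read at the term's data (`zppOfRecordT`: `L`, `M`, `R_j = RkOfRecord L r g_j`, `k₀ = k′ − N₀`, `k′`,
`omegaOfChain s`, `Z`) and proves that the pin is COHERENT with module 13's printed members: for EVERY `j > h`, `zppOfChain … (zppOfRecordT …) j = zppOfRecordT … j` — at `j = k′`,
`k₀ + 1` and `h < j ≤ k₀` because module 13's formulas `(Ω^{∼5}_{k₀+1})ᶜ ∩ Z`, `(Ω^{∼7}_{k₀+1})ᶜ ∩ Z`, `(Ω_j^{∼5})ᶜ ∩ Z` over def-T's `hullD` on `T_η` ARE p29's cover-side `farZ`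
members descended to `T_η`.  That identification needs ONE geometric fact, proved in §1: THE COVER BRIDGE `π⁻¹(hullD P s n X) = enl s n (π⁻¹X)` (`s ∣ 2L^{m+K}`) between def-T's
torus enlargement and pv02's cover enlargement — one notion of *«surrounded by n layers»* ([III] p. 265) on the two carriers of the tree.  Then (§3) p29's certified structure
transfers BY NAME to the situation's own regions: nested above `h`, disjoint from `Ω_j`, `Z∖Z″_{h+1} ⊆ Ω_h`, and the (1.12) domains built from them ADMISSIBLE on the cover (under p29's
located `Hypotheses` on the term's data); (§4) module 18's display at the `Zres`-pinned stack.  After this file the ONLY residual region letter of the situation is `Z`.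

* §1 THE COVER BRIDGE: `cubeIdx_of_mem_cubeExt_zero`, `abs_cubeIdx_sub_le_of_mem_cubeExt`, `mem_cubeExt_of_abs_cubeIdx_sub_le` (collar ↔ index distance), `cubeIdx_add_pmul`,
  `idxNear_add_pmul_iff`, `mem_enl_preimage_add_pmul_iff` (deck invariance, side dividing the period), ★ **`preimage_cover_hullD`**, `preimage_cover_compl_hullD_inter`,
  `compl_hullD_inter_eq_image_farZ`.
* §2 `omegaT` (the chain as torus data with print's `Ω₀ = T_η`), `zppOfRecordT` (+ `_apply`, `_subset`), `dCubeSide_eq_side_mul`, THE PIN **`Node00.Sit189.pinZres σ ν M g s N₀`** (+ faces, comm, `pinZres_then_pinZpp`), ★ **`zppOfChain_eq_zppOfRecordT`**.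
* §3 AT THE FULL STACK `pinZres → pinSides → pinXΩ4 → pinOmegaPP → pinLambda → pinDistAt → pinZpp → pinCubes → sitOfHist`: `Zpp_stack` (`rfl`), ★★ `Zpp_stack_eq_zppOfRecordT`,
  `Zpp_stack_subset_Z`, ★★ `Zpp_stack_structure` (p29's `zppT_mono ∕ zppT_disjoint ∕ Z_diff_zppT_subset ∕ admissible_record` by name), `Zpp_stack_low` (below `h`: module 13's `Z_j ∩ Z`).
* §4 THE (1.89) DISPLAY AT THE `Zres`-PINNED STACK: ★★★ `claim189_sitOfHist_ΛΩχZ_of_flow`, `claim189_sitOfHist₁₃_ΛΩχZ_of_inInterval` (module 18's theorems at `σ := σ.pinZres …`).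

LOCATED (nothing asserted): (i) the identification `Zpp_stack_eq_zppOfRecordT` needs the cube sides in use to divide the torus period `2L^{m+K}` (the `M`-cubes of the top scale,
`L^{k′}M`, and the `L^{−(k−j)}MR_j`-cubes, `h < j ≤ k₀`) — print's standing arrangement of compatible partitions, the same hypotheses as p29's bridge `preimage_omegaPP_record`; and
print's `N₀`-equation in p29's form `L^{k₀+1}MR_{k₀+1} = L^{k′}M` (p29's `Hypotheses.hN₀`; module 16 §3 `RkOfRecord_eq_pow_N0OfSeq` derives `R_{k₀+1} = L^{N₀−1}` from one step of
monotone couplings); (ii) the STRUCTURE (nesting, disjointness, admissibility) is p29's, under p29's located `Hypotheses` on the cover data of the term (the chain `{Ω_j}` pulled back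
[III]-(2.13)-admissible — the separation of the (2.1)-chain —, the p. 177 (ii) eight-layer margin inside `Z`, `Z` a union of `MR_k`-cube components of `Λ_kᶜ` closed under adjacency
outside `Ω_k`, `N > N₀ ≥ 2`); this file does not derive `Hypotheses` from the record (the (2.1)-chain's separation is def-R ∕ def-P11's `Sect2.SeqSeparated` business); (iii) below
`h` (`j + N ≤ k′`) the stack's `Z″_j` is module 13's `Λ_jᶜ ∩ Z` (print's `Z″_j = Z_j`), NOT `zppOfRecordT j` (p29's torus sequence does not model the old regions); (iv) which
completion print takes is not fixed (*«in such a way that»*); p29 §6 covers every admissible completion, §4 exhibits the thinnest — the one pinned here.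

HONEST FRAMING.  Count-neutral: one data transformer, a cover∕torus bridge for cube layers, set algebra, and p29's theorems by name; NO estimate of Bałaban's asserted; N12 NOT
discharged; one finite four-torus programme at fixed `ε`, Bałaban AS PRINTED with locators; nothing continuum ∕ ℝ⁴ ∕ OS ∕ mass gap ∕ Clay.  No `sorry`, no `axiom`, no `instance`,
no `notation`.
-/

noncomputable section

open scoped BigOperators

namespace Literature.MathematicalPhysics.QuantumFieldTheory.Balaban1983to89

namespace B15Claim189ZppOfRecordPin

open DagBinding T4Continuum Node00
open B14DomainGeom (Pt cubeIdx cubeIdx_le IdxNear enl)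
open B14.Eq213MaximalDomains (cubeExt)
open B15Eq112TorusCover (cover lift per cover_lift cover_eq_cover_iff cover_add_pmul image_preimage)
open B15LatticeCubeTorus (pmul cubeIdx_sub_pmul)
open B15Claim189CubePin (cubeOfSite cubeOfSite_mem_cubeIndices mem_cubeEnl_cubeOfSite lift_lt_mul_cubeIdx_add)

/-! ## §1. The universal-cover bridge for def-T's layer enlargement: `π⁻¹(X^{∼n}) = (π⁻¹X)^{∼n}` -/

section Bridge

variable {P : Params}

/-- A point of the `s`-cube of index `a` (no collar) has cube index `a`. [cite: Balaban1988Convergent, (2.16)–(2.17) p.257 (bookkeeping)] -/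
theorem cubeIdx_of_mem_cubeExt_zero {s : ℕ} (hs : 0 < s) {x a : Pt P.d} (hx : x ∈ cubeExt s a 0) : cubeIdx s x = a := by
  funext i
  obtain ⟨h1, h2⟩ := hx i
  have hs' : (0 : ℤ) < s := by exact_mod_cast hs
  unfold cubeIdx
  refine le_antisymm ?_ ?_
  · have : x i < (a i + 1) * (s : ℤ) := by linarith
    have h := Int.ediv_lt_iff_lt_mul hs' |>.2 this
    omega
  · exact Int.le_ediv_iff_mul_le hs' |>.2 (by linarith)

/-- A point of the `n·s`-collar of the `s`-cube of index `a` has cube index within `n` of `a` in every coordinate.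
[cite: Balaban1988Convergent, (2.16)–(2.17) p.257, p.265 («surrounded by n layers»; bookkeeping)] -/
theorem abs_cubeIdx_sub_le_of_mem_cubeExt {s : ℕ} (hs : 0 < s) (n : ℕ) {y a : Pt P.d} (hy : y ∈ cubeExt s a ((n * s : ℕ) : ℤ)) (i : Fin P.d) :
    |cubeIdx s y i - a i| ≤ n := by
  obtain ⟨h1, h2⟩ := hy i
  have hs' : (0 : ℤ) < s := by exact_mod_cast hs
  have hlo : a i - n ≤ cubeIdx s y i := by
    unfold cubeIdx
    refine Int.le_ediv_iff_mul_le hs' |>.2 ?_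
    push_cast at h1
    nlinarith
  have hhi : cubeIdx s y i ≤ a i + n := by
    unfold cubeIdx
    have : y i < (a i + n + 1) * (s : ℤ) := by push_cast at h2; nlinarith
    have h := Int.ediv_lt_iff_lt_mul hs' |>.2 this
    omega
  rw [abs_le]
  constructor <;> linarith

/-- Conversely, a point whose cube index is within `n` of `a` lies in the `n·s`-collar of the cube of index `a`.
[cite: Balaban1988Convergent, (2.16)–(2.17) p.257 (bookkeeping)] -/
theorem mem_cubeExt_of_abs_cubeIdx_sub_le {s : ℕ} (hs : 0 < s) (n : ℕ) {y a : Pt P.d} (h : ∀ i, |cubeIdx s y i - a i| ≤ n) :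
    y ∈ cubeExt s a ((n * s : ℕ) : ℤ) := by
  intro i
  have hb1 := cubeIdx_le s hs y i
  have hb2 := lift_lt_mul_cubeIdx_add s hs y i
  have hs' : (0 : ℤ) ≤ s := by exact_mod_cast hs.le
  obtain ⟨hl, hu⟩ := abs_le.1 (h i)
  push_cast
  constructor
  · have : (s : ℤ) * (a i - n) ≤ (s : ℤ) * cubeIdx s y i := mul_le_mul_of_nonneg_left (by linarith) hs'
    linarith
  · have : (s : ℤ) * cubeIdx s y i ≤ (s : ℤ) * (a i + n) := mul_le_mul_of_nonneg_left (by linarith) hs'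
    linarith

/-- Cube indices under a deck translation `x ↦ x + (2L^{m+K})·v` when the side divides the period: shifted by `(2L^{m+K}∕s)·v`.
[cite: Balaban1987RG1, (0.1) p.251 (the torus; bookkeeping)] -/
theorem cubeIdx_add_pmul {s : ℕ} (hs : 0 < s) (hdvd : s ∣ P.sitesPerDir 0) (x v : Pt P.d) (i : Fin P.d) :
    cubeIdx s (x + pmul (per P) v) i = cubeIdx s x i + ((P.sitesPerDir 0 / s : ℕ) : ℤ) * v i := by
  have h := cubeIdx_sub_pmul (P := per P) (fun _ => hdvd) hs x (-v) i
  have e : x - pmul (per P) (-v) = x + pmul (per P) v := by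
    funext μ; simp [pmul, sub_eq_add_neg]
  rw [e] at h
  rw [h]
  simp [per]

/-- Cube-index nearness is deck-invariant when the side divides the period. [cite: Balaban1987RG1, (0.1) p.251 (bookkeeping)] -/
theorem idxNear_add_pmul_iff {s n : ℕ} (hs : 0 < s) (hdvd : s ∣ P.sitesPerDir 0) (x y v : Pt P.d) :
    IdxNear s n (x + pmul (per P) v) (y + pmul (per P) v) ↔ IdxNear s n x y := by
  unfold IdxNear
  refine forall_congr' fun i => ?_
  rw [cubeIdx_add_pmul hs hdvd, cubeIdx_add_pmul hs hdvd]
  ring_nf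

/-- The layer enlargement of a pull-back is deck-invariant (side dividing the period). [cite: Balaban1988Convergent, p.265; Balaban1987RG1, (0.1) p.251 (bookkeeping)] -/
theorem mem_enl_preimage_add_pmul_iff {s n : ℕ} (hs : 0 < s) (hdvd : s ∣ P.sitesPerDir 0) (X : Set (Site P 0)) (x v : Pt P.d) :
    x + pmul (per P) v ∈ enl s n (cover P ⁻¹' X) ↔ x ∈ enl s n (cover P ⁻¹' X) := by
  constructor
  · rintro ⟨y, hy, hn⟩
    refine ⟨y + pmul (per P) (-v), ?_, ?_⟩
    · simpa [Set.mem_preimage, cover_add_pmul] using hy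
    · have e : x = (x + pmul (per P) v) + pmul (per P) (-v) := by funext μ; simp [pmul]
      rw [e]
      exact (idxNear_add_pmul_iff hs hdvd _ _ _).2 hn
  · rintro ⟨y, hy, hn⟩
    refine ⟨y + pmul (per P) v, ?_, (idxNear_add_pmul_iff hs hdvd _ _ _).2 hn⟩
    simpa [Set.mem_preimage, cover_add_pmul] using hy

/-- ★ **THE COVER BRIDGE FOR def-T's LAYER ENLARGEMENT**: when the cube side divides the torus period, the pull-back to the universal cover `ℤᵈ` of
`hullD P s n X` (the `s`-cubes of `T_η` within `n` layers of `X`) is pv02's `B14DomainGeom.enl s n` of the pull-back of `X` (the points whose cube index is within `n`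
of the index of a point over `X`) — ONE enlargement notion on the two carriers of the tree. [cite: Balaban1988Convergent, (2.16)–(2.17) p.257, p.264–265; Balaban1987RG1, (0.1) p.251] -/
theorem preimage_cover_hullD {s : ℕ} (hs : 0 < s) (hdvd : s ∣ P.sitesPerDir 0) (n : ℕ) (X : Set (Site P 0)) :
    cover P ⁻¹' hullD P s n X = enl s n (cover P ⁻¹' X) := by
  classical
  ext x
  constructor
  · intro hx
    rw [Set.mem_preimage] at hx
    unfold hullD at hx
    obtain ⟨a, ha, hxa⟩ := Set.mem_iUnion₂.1 hx
    obtain ⟨-, t, hta, htX⟩ := Finset.mem_filter.1 ha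
    obtain ⟨x', hx', hxx'⟩ := hxa
    obtain ⟨y', hy', hyt⟩ := hta
    -- `x'` lies in the cube `a`, `y'` in its `n·s`-collar and over `X`
    have hidx : cubeIdx s x' = a := cubeIdx_of_mem_cubeExt_zero hs (by simpa using hx')
    have hx'enl : x' ∈ enl s n (cover P ⁻¹' X) := by
      refine ⟨y', by rw [Set.mem_preimage, hyt]; exact htX, fun i => ?_⟩
      rw [hidx, abs_sub_comm]
      exact abs_cubeIdx_sub_le_of_mem_cubeExt hs n hy' i
    obtain ⟨v, rfl⟩ := (cover_eq_cover_iff x' x).1 (by rw [hxx'])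
    exact (mem_enl_preimage_add_pmul_iff hs hdvd X x' v).2 hx'enl
  · rintro ⟨y, hy, hn⟩
    rw [Set.mem_preimage]
    -- work at the standard lift of `cover x`, a deck translate of `x`
    obtain ⟨v, hv⟩ := (cover_eq_cover_iff x (lift P (cover P x))).1 (by rw [cover_lift])
    have hy' : y + pmul (per P) v ∈ cubeExt s (cubeOfSite s (cover P x)) ((n * s : ℕ) : ℤ) := by
      refine mem_cubeExt_of_abs_cubeIdx_sub_le hs n fun i => ?_
      have e : cubeOfSite s (cover P x) = cubeIdx s (x + pmul (per P) v) := by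
        unfold cubeOfSite; rw [hv]
      rw [e, cubeIdx_add_pmul hs hdvd, cubeIdx_add_pmul hs hdvd]
      have := hn i
      rw [abs_sub_comm] at this
      calc |cubeIdx s y i + ((P.sitesPerDir 0 / s : ℕ) : ℤ) * v i - (cubeIdx s x i + ((P.sitesPerDir 0 / s : ℕ) : ℤ) * v i)|
          = |cubeIdx s y i - cubeIdx s x i| := by ring_nf
        _ ≤ n := this
    unfold hullD
    refine Set.mem_iUnion₂.2 ⟨cubeOfSite s (cover P x), Finset.mem_filter.2 ⟨cubeOfSite_mem_cubeIndices s hs _, cover P y, ⟨_, hy', ?_⟩, hy⟩,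
      mem_cubeEnl_cubeOfSite s hs _⟩
    simp [cover_add_pmul]

/-- The bridge for print's `(X^{∼n})ᶜ ∩ Z` shape: the pull-back of `(hullD P s n Ω)ᶜ ∩ Z` is b02's `farZ s n (π⁻¹Ω) (π⁻¹Z)` on the cover.
[cite: Balaban1989LargeFieldI, (1.10) p.179; Balaban1988Convergent, p.265] -/
theorem preimage_cover_compl_hullD_inter {s : ℕ} (hs : 0 < s) (hdvd : s ∣ P.sitesPerDir 0) (n : ℕ) (Ω Z : Set (Site P 0)) :
    cover P ⁻¹' ((hullD P s n Ω)ᶜ ∩ Z) = B16Stage3Regions.farZ s n (cover P ⁻¹' Ω) (cover P ⁻¹' Z) := by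
  rw [Set.preimage_inter, Set.preimage_compl, preimage_cover_hullD hs hdvd, B16Stage3Regions.farZ]

/-- … hence `(hullD P s n Ω)ᶜ ∩ Z` IS the image of that `farZ` (the cover is onto). [cite: Balaban1989LargeFieldI, (1.10) p.179] -/
theorem compl_hullD_inter_eq_image_farZ {s : ℕ} (hs : 0 < s) (hdvd : s ∣ P.sitesPerDir 0) (n : ℕ) (Ω Z : Set (Site P 0)) :
    (hullD P s n Ω)ᶜ ∩ Z = cover P '' B16Stage3Regions.farZ s n (cover P ⁻¹' Ω) (cover P ⁻¹' Z) := by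
  rw [← preimage_cover_compl_hullD_inter hs hdvd, image_preimage]

end Bridge

/-! ## §2. THE PIN: module 13's residual interpolating sets `Zres :=` lit-balaban's torus large-field regions of record `ZppT` -/

section Pin

open B15Claim189PrintedConditions (omegaOfChain)
open B15Claim189ZppPin (zppOfChain zppOfChain_mid zppOfChain_k₀succ zppOfChain_top)
open B15Claim189LambdaPin (enlD enlD_apply dCubeSide_pos)
open B15Eq112TorusCover (ZppT ZppC pullSeq zppT_subset)
open B15Eq112Admissible (completion completion_top completion_bot zpp_of_le zpp_of_lt)
open B16Stage3Regions (farZ Zk Zk0)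
open B14.Eq213MaximalDomains (side)

variable (F : T4Family) (ν : Stage7Numerics) (M : ℕ) (P : B12.RunParams) (g : ℕ → ℝ)

/-- **THE TERM's (2.1)-CHAIN AS TORUS DATA FOR lit-balaban's CONSTRUCTION, WITH PRINT's `Ω₀ = T_η`**: module 11's clamped chain `omegaOfChain s j = Ω_{max(1,min(j,k′))}` at every
`j ≥ 1`, and THE WHOLE TORUS at `j = 0` ([III] (2.2): the finest scale carries everything, `Γ₀ = Ω₁ᶜ`; p29's standing convention `Ω₀ = T_η` in `B15Eq112Admissible` §8 and its
instances).  Only the levels `j ≥ 1` are read by the regions below; the level `0` matters for p29's `Admissible` ∕ `Hypotheses` bundles (§3).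
[cite: Balaban1988Convergent, (2.1)–(2.2) p.254; Balaban1989LargeFieldI, (1.12) p.179] -/
def omegaT {K k' : ℕ} (s : SeqOfRecord F ν M g K k') : ℕ → Set (Site (F.P K) 0) := fun j => if j = 0 then Set.univ else omegaOfChain s j

/-- `Ω₀ = T_η` (`rfl`-level). [cite: Balaban1988Convergent, (2.2) p.254] -/
theorem omegaT_zero {K k' : ℕ} (s : SeqOfRecord F ν M g K k') : omegaT F ν M g s 0 = Set.univ := by simp [omegaT]

/-- Above level `0` the torus data IS the term's clamped chain. [cite: Balaban1988Convergent, (2.1) p.254] -/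
theorem omegaT_of_ne_zero {K k' : ℕ} (s : SeqOfRecord F ν M g K k') {j : ℕ} (hj : j ≠ 0) : omegaT F ν M g s j = omegaOfChain s j := by simp [omegaT, hj]

/-- … so its pull-back to the cover at a level `j ≠ 0` is the pull-back of `Ω_j`. [cite: Balaban1988Convergent, (2.1) p.254 (bookkeeping)] -/
theorem pullSeq_omegaT_of_ne_zero {K k' : ℕ} (s : SeqOfRecord F ν M g K k') {j : ℕ} (hj : j ≠ 0) :
    pullSeq (omegaT F ν M g s) j = cover (F.P K) ⁻¹' omegaOfChain s j := by
  simp [pullSeq, omegaT, hj]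

/-- **THE TORUS LARGE-FIELD REGIONS OF RECORD OF THE TERM** — lit-balaban p29's `B15Eq112TorusCover.ZppT` (print's (1.10)–(1.11) WITH the constructed completion
*«complete these two sets to a sequence … in such a way that the complements of these sets form an admissible sequence of domains based on partitions into M-cubes in
the corresponding scales»*, p. 179, built on the universal cover by p29's `B15Eq112Admissible.completion` and descended to `T_η`) READ AT THE TERM'S DATA: the fine torus
`F.P P.K`, the `M`-cube side `side L M j = L^jM`, `R_j = RkOfRecord L r g_j` of [III] (2.5) along the history `g`, `k₀ := k′ − N₀`, top scale `k′`, the term's clamped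
(2.1)-chain with `Ω₀ = T_η` (`omegaT s`), and the component union `Z`. [cite: Balaban1989LargeFieldI, (1.10)–(1.11) p.179; Balaban1988Convergent, (2.5) p.255] -/
def zppOfRecordT {k' : ℕ} (s : SeqOfRecord F ν M g P.K k') (N₀ : ℕ) (Z : Set (Site (F.P P.K) 0)) : ℕ → Set (Site (F.P P.K) 0) :=
  ZppT (F.P P.K).L M (k' - N₀) k' (fun j => RkOfRecord (F.P P.K).L ν.r (g j)) (omegaT F ν M g s) Z

variable {F ν M P g}

/-- Unfolding (`rfl`). [cite: Balaban1989LargeFieldI, (1.10)–(1.11) p.179 (bookkeeping)] -/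
theorem zppOfRecordT_apply {k' : ℕ} (s : SeqOfRecord F ν M g P.K k') (N₀ : ℕ) (Z : Set (Site (F.P P.K) 0)) (j : ℕ) :
    zppOfRecordT F ν M P g s N₀ Z j = ZppT (F.P P.K).L M (k' - N₀) k' (fun j => RkOfRecord (F.P P.K).L ν.r (g j)) (omegaT F ν M g s) Z j := rfl

/-- `Z″_j` of record lies in `Z` (p29's `zppT_subset`, hypothesis-free). [cite: Balaban1989LargeFieldI, (1.11) p.179] -/
theorem zppOfRecordT_subset {k' : ℕ} (s : SeqOfRecord F ν M g P.K k') (N₀ : ℕ) (Z : Set (Site (F.P P.K) 0)) (j : ℕ) :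
    zppOfRecordT F ν M P g s N₀ Z j ⊆ Z := zppT_subset j

/-- def-T's `𝐃_j`-cube side IS r11's `M`-cube side times `R_j`: `L^jMR_j = (L^jM)·R_j` (`rfl`). [cite: Balaban1988Convergent, (2.1) p.254, (2.13) p.256 (bookkeeping)] -/
theorem dCubeSide_eq_side_mul (L M' Rk j : ℕ) : dCubeSide L M' Rk j = side L M' j * Rk := rfl

variable {N : ℕ} [NeZero N]

/-- **THE (1.89) SITUATION WITH ITS `Z″`-INTERPOLATION PINNED**: the situation's `Zpp` field — read by module 13's `pinZpp` as the residual interpolating family `Zres` of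
`zppOfChain` — is SET TO the torus large-field regions of record `zppOfRecordT … s N₀ σ.Z` of the term.  ORDER: before module 13's `pinZpp` (which reads `Zpp`); it reads `Z`
(term data).  Data, no law. [cite: Balaban1989LargeFieldI, (1.10)–(1.11) p.179, (1.89) p.198] -/
def _root_.Literature.MathematicalPhysics.QuantumFieldTheory.Balaban1983to89.Node00.Sit189.pinZres (σ : Sit189 F N P.K) (ν : Stage7Numerics) (M : ℕ) (g : ℕ → ℝ)
    {k' : ℕ} (s : SeqOfRecord F ν M g P.K k') (N₀ : ℕ) : Sit189 F N P.K :=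
  { σ with Zpp := zppOfRecordT F ν M P g s N₀ σ.Z }

variable (σ : Sit189 F N P.K) {k' : ℕ} (s : SeqOfRecord F ν M g P.K k') (N₀ : ℕ)

/-- The pinned field (`rfl`). [cite: Balaban1989LargeFieldI, (1.10) p.179 (bookkeeping)] -/
theorem pinZres_Zpp : (σ.pinZres ν M g s N₀).Zpp = zppOfRecordT F ν M P g s N₀ σ.Z := rfl

/-- The pin keeps every other field (`rfl`; `HEq` for the chart letter). [cite: Balaban1989LargeFieldI, (1.89) p.198 (bookkeeping)] -/
theorem pinZres_kept : (σ.pinZres ν M g s N₀).𝔤 = σ.𝔤 ∧ HEq (σ.pinZres ν M g s N₀).chiP σ.chiP ∧ (σ.pinZres ν M g s N₀).h = σ.h ∧ (σ.pinZres ν M g s N₀).k₀ = σ.k₀ ∧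
    (σ.pinZres ν M g s N₀).k = σ.k ∧ (σ.pinZres ν M g s N₀).sh = σ.sh ∧ (σ.pinZres ν M g s N₀).sk = σ.sk ∧ (σ.pinZres ν M g s N₀).Ω = σ.Ω ∧
    (σ.pinZres ν M g s N₀).Z = σ.Z ∧ (σ.pinZres ν M g s N₀).Λ = σ.Λ ∧ (σ.pinZres ν M g s N₀).OmT = σ.OmT ∧ (σ.pinZres ν M g s N₀).ΩppT2 = σ.ΩppT2 ∧
    (σ.pinZres ν M g s N₀).β = σ.β ∧ (σ.pinZres ν M g s N₀).L₀ = σ.L₀ ∧ (σ.pinZres ν M g s N₀).α = σ.α ∧ (σ.pinZres ν M g s N₀).δ = σ.δ ∧ (σ.pinZres ν M g s N₀).B₃ = σ.B₃ ∧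
    (σ.pinZres ν M g s N₀).B₅ = σ.B₅ ∧ (σ.pinZres ν M g s N₀).M = σ.M ∧ (σ.pinZres ν M g s N₀).O1 = σ.O1 ∧ (σ.pinZres ν M g s N₀).dist = σ.dist ∧
    (σ.pinZres ν M g s N₀).Xhalf = σ.Xhalf ∧ (σ.pinZres ν M g s N₀).XH = σ.XH ∧ (σ.pinZres ν M g s N₀).XΩ4 = σ.XΩ4 ∧ (σ.pinZres ν M g s N₀).boxOf = σ.boxOf ∧
    (σ.pinZres ν M g s N₀).dev0 = σ.dev0 ∧ (σ.pinZres ν M g s N₀).devV'' = σ.devV'' ∧ (σ.pinZres ν M g s N₀).dev97 = σ.dev97 :=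
  ⟨rfl, HEq.rfl, rfl, rfl, rfl, rfl, rfl, rfl, rfl, rfl, rfl, rfl, rfl, rfl, rfl, rfl, rfl, rfl, rfl, rfl, rfl, rfl, rfl, rfl, rfl, rfl, rfl, rfl⟩

/-- The `Zres`-pin commutes with the side, `Ω″`, `Λ`, distance and cube pins and with module 14's term ∕ levels pins (`rfl`: disjoint fields) — NOT with module 13's `pinZpp`,
which READS it and comes after it. [cite: Balaban1989LargeFieldI, (1.89) p.198 (bookkeeping)] -/
theorem pinZres_comm (h k Nm Mn Nm' N₀' kd : ℕ) (S : Set (Site (F.P P.K) 0)) (enl : ℕ → ℕ → Set (Site (F.P P.K) 0) → Set (Site (F.P P.K) 0)) :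
    (σ.pinZres ν M g s N₀).pinSides ν g h k = (σ.pinSides ν g h k).pinZres ν M g s N₀ ∧
    (σ.pinZres ν M g s N₀).pinOmegaPP s Nm enl = (σ.pinOmegaPP s Nm enl).pinZres ν M g s N₀ ∧
    (σ.pinZres ν M g s N₀).pinLambda s N₀' enl = (σ.pinLambda s N₀' enl).pinZres ν M g s N₀ ∧
    (σ.pinZres ν M g s N₀).pinDistAt kd = (σ.pinDistAt kd).pinZres ν M g s N₀ ∧ (σ.pinZres ν M g s N₀).pinCubes S = (σ.pinCubes S).pinZres ν M g s N₀ ∧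
    (σ.pinZres ν M g s N₀).pinTerm s = (σ.pinTerm s).pinZres ν M g s N₀ ∧ (σ.pinZres ν M g s N₀).pinLevels Mn Nm' N₀' = (σ.pinLevels Mn Nm' N₀').pinZres ν M g s N₀ :=
  ⟨rfl, rfl, rfl, rfl, rfl, rfl, rfl⟩

/-- After the `Zres`-pin, module 13's `Z″` pin builds `zppOfChain` WITH the torus regions of record as its interpolating family (`rfl`).
[cite: Balaban1989LargeFieldI, (1.10)–(1.11) p.179 (bookkeeping)] -/
theorem pinZres_then_pinZpp (Nm : ℕ) (enl : ℕ → ℕ → Set (Site (F.P P.K) 0) → Set (Site (F.P P.K) 0)) :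
    ((σ.pinZres ν M g s N₀).pinZpp s N₀ Nm enl).Zpp = zppOfChain s N₀ Nm σ.Z enl (zppOfRecordT F ν M P g s N₀ σ.Z) := rfl

/-- ★ **MODULE 13's `Z″` OVER THE ENLARGEMENT OF RECORD, INTERPOLATED BY THE TORUS REGIONS OF RECORD, IS THAT TORUS SEQUENCE — AT EVERY SCALE ABOVE `h`.**
For `j > h = k′ − N` (and `2 ≤ N₀ ≤ N`, `N₀ ≤ k′`, `0 < M`): `zppOfChain s N₀ N Z enlD (zppOfRecordT … s N₀ Z) j = zppOfRecordT … s N₀ Z j`.  In the interpolated range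
`k₀ + 2 ≤ j ≤ k′ − 1` (and above `k′`) this is the definition of the pin; at `j = k′`, `j = k₀ + 1` and `h < j ≤ k₀` it is the statement that module 13's printed formulas
`(Ω^{∼5}_{k₀+1})ᶜ ∩ Z`, `(Ω^{∼7}_{k₀+1})ᶜ ∩ Z`, `(Ω_j^{∼5})ᶜ ∩ Z` over def-T's `hullD` on the torus ARE p29's cover-side `farZ` members descended to `T_η` — the §1 bridge, with
the cube sides in use dividing the torus period (print's standing arrangement of compatible partitions) and print's `N₀`-equation in p29's form `L^{k₀+1}MR_{k₀+1} = L^{k′}M`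
(module 16 §3 derives it from one step of monotone couplings). [cite: Balaban1989LargeFieldI, (1.10)–(1.11) p.179; Balaban1988Convergent, (2.1) p.254, (2.5) p.255, p.265; Balaban1987RG1, (0.1) p.251] -/
theorem zppOfChain_eq_zppOfRecordT (Z : Set (Site (F.P P.K) 0)) {Nm : ℕ} (hM : 0 < M) (hN2 : 2 ≤ N₀) (hNm : N₀ ≤ Nm) (hNk : N₀ ≤ k')
    (hdk : side (F.P P.K).L M k' ∣ (F.P P.K).sitesPerDir 0)
    (hdj : ∀ j, k' - Nm < j → j ≤ k' - N₀ → dCubeSide (F.P P.K).L M (RkOfRecord (F.P P.K).L ν.r (g j)) j ∣ (F.P P.K).sitesPerDir 0)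
    (hN₀eq : dCubeSide (F.P P.K).L M (RkOfRecord (F.P P.K).L ν.r (g (k' + 1 - N₀))) (k' + 1 - N₀) = side (F.P P.K).L M k')
    {j : ℕ} (hj : k' - Nm < j) :
    zppOfChain s N₀ Nm Z (enlD F ν M P g) (zppOfRecordT F ν M P g s N₀ Z) j = zppOfRecordT F ν M P g s N₀ Z j := by
  have hside_pos : 0 < side (F.P P.K).L M k' := by
    rw [← hN₀eq]; exact dCubeSide_pos (F := F) (ν := ν) (P := P) (g := g) hM _
  -- the torus member of record at `j`, unfolded to the image of the cover member's trace
  have hT : ∀ i, zppOfRecordT F ν M P g s N₀ Z i =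
      cover (F.P P.K) '' (ZppC (F.P P.K).L M (k' - N₀) k' (fun j => RkOfRecord (F.P P.K).L ν.r (g j)) (omegaT F ν M g s) Z i ∩ cover (F.P P.K) ⁻¹' Z) := fun i => rfl
  -- a `farZ` member lies over `Z`, so the trace is superfluous
  have htrace : ∀ (t n : ℕ) (Ω' : Set (Site (F.P P.K) 0)),
      farZ t n (cover (F.P P.K) ⁻¹' Ω') (cover (F.P P.K) ⁻¹' Z) ∩ cover (F.P P.K) ⁻¹' Z = farZ t n (cover (F.P P.K) ⁻¹' Ω') (cover (F.P P.K) ⁻¹' Z) :=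
    fun t n Ω' => Set.inter_eq_left.mpr (fun x hx => hx.2)
  by_cases hmid : j ≤ k' - N₀
  · -- `h < j ≤ k₀`: (1.11) middle regime on both sides
    rw [zppOfChain_mid s N₀ Nm Z _ _ (by omega) (by omega), hT, ZppC, zpp_of_le (by omega), pullSeq_omegaT_of_ne_zero F ν M g s (show j ≠ 0 by omega), htrace, enlD_apply,
      compl_hullD_inter_eq_image_farZ (dCubeSide_pos (F := F) (ν := ν) (P := P) (g := g) hM j) (hdj j hj hmid)]
    rfl
  by_cases hbot : j = k' + 1 - N₀
  · -- `j = k₀ + 1`: (1.10) second member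
    subst hbot
    rw [zppOfChain_k₀succ s N₀ Nm Z _ _ hNm (by omega), hT, ZppC, zpp_of_lt (by omega),
      show k' + 1 - N₀ = k' - N₀ + 1 from by omega, completion_bot, compl_compl, Zk0, omegaT_of_ne_zero F ν M g s (show k' - N₀ + 1 ≠ 0 by omega), htrace, enlD_apply,
      show k' - N₀ + 1 = k' + 1 - N₀ from by omega, hN₀eq, compl_hullD_inter_eq_image_farZ hside_pos hdk]
  by_cases htop : j = k'
  · -- `j = k′`: (1.10) first member
    rw [htop, zppOfChain_top s N₀ Nm Z _ _ hN2 hNm, hT, ZppC, zpp_of_lt (by omega), completion_top (by omega), compl_compl, Zk,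
      omegaT_of_ne_zero F ν M g s (show k' - N₀ + 1 ≠ 0 by omega), htrace, enlD_apply, hN₀eq,
      compl_hullD_inter_eq_image_farZ hside_pos hdk, show k' + 1 - N₀ = k' - N₀ + 1 from by omega]
  · -- the interpolated range `k₀ + 2 ≤ j ≤ k′ − 1` (and `j > k′`): the pin itself
    have h1 : ¬ j + Nm ≤ k' := by omega
    have h2 : ¬ j + N₀ ≤ k' := by omega
    have h3 : ¬ j + N₀ = k' + 1 := by omega
    simp only [zppOfChain, if_neg h1, if_neg h2, if_neg h3, if_neg htop]

end Pin

/-! ## §3. At the fully pinned stack: the situation's `Z″_j`, `j > h`, ARE the torus regions of record; p29's certified properties transfer BY NAME -/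

section Stack

open B15Claim189Assembly (Setting189)
open B15Claim189PinsOfHistory (D189OfHist sitOfHist)
open B15Claim189PrintedConditions (omegaOfChain omegaOfChain_succ_subset)
open B15Claim189ZppPin (zppOfChain zppOfChain_low)
open B15Claim189LambdaPin (enlD)
open B15DeterminingSets (MSField)
open B15Eq112TorusCover (ZppT pullSeq zppT_subset zppT_mono zppT_disjoint Z_diff_zppT_subset admissible_record)
open B15Eq112Admissible (Hypotheses Admissible)
open B14.Eq213MaximalDomains (side)

variable {F : T4Family} {N : ℕ} [NeZero N] {ν : Stage7Numerics} {A₁ : ℝ} {M : ℕ} (Nm : ℕ) (P : B12.RunParams) (σ : Sit189 F N P.K) {g : ℕ → ℝ} {k' : ℕ}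
  (s : SeqOfRecord F ν M g P.K k') (N₀ p₁ kd hs' : ℕ) (S : Set (Site (F.P P.K) 0)) (enl₁ enl₂ enl₃ : ℕ → ℕ → Set (Site (F.P P.K) 0) → Set (Site (F.P P.K) 0))

/-- At the stack `pinZres → pinSides → pinXΩ4 → pinOmegaPP → pinLambda → pinDistAt → pinZpp → pinCubes → sitOfHist` the letters' `Z″` IS module 13's `zppOfChain` over the enlargement of
record INTERPOLATED BY THE TORUS REGIONS OF RECORD (`rfl`). [cite: Balaban1989LargeFieldI, (1.10)–(1.11) p.179, (1.89) p.198 (bookkeeping)] -/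
theorem Zpp_stack
    {D : Setting189 (F.P P.K) (SU N) (MSField (F.P P.K) (SU N) × ((j : ℕ) → VecField (F.P P.K) j (EuclideanSpace ℝ (Fin (N ^ 2 - 1))))) (Pt (F.P P.K).d)}
    (hD : D = D189OfHist ν P (sitOfHist ν A₁ M Nm P
      ((((((((σ.pinZres ν M g s N₀).pinSides ν g hs' k').pinXΩ4 s enl₁).pinOmegaPP s Nm enl₂).pinLambda s N₀ enl₃).pinDistAt kd).pinZpp s N₀ Nm (enlD F ν M P g)).pinCubes S) g s N₀ p₁) g) :
    D.Zpp = zppOfChain s N₀ Nm σ.Z (enlD F ν M P g) (zppOfRecordT F ν M P g s N₀ σ.Z) := by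
  subst hD; rfl

/-- ★★ **THE (1.89) SITUATION's NEW LARGE-FIELD REGIONS ARE lit-balaban's TORUS REGIONS OF RECORD ABOVE `h`**: at the fully pinned stack, for every `j > h = k′ − N`,
`Z″_j = ZppT L M k₀ k′ R {Ω_j} Z j` — print's (1.10)–(1.11) WITH p29's constructed completion (for which *«{Ω″_j} is an admissible sequence»* is PROVED, `B15Eq112Admissible`).  Inputs:
`2 ≤ N₀ ≤ N`, `N₀ ≤ k′`, `0 < M`, the cube sides in use dividing the torus period, and print's `N₀`-equation (§2).  CONSEQUENCE: the configuration `U″_{k,Z}` of (1.21) — which reads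
EVERY `Z″_j`, `h < j ≤ k`, through the determining sets (1.14)–(1.19) — is now determined by the term's data `(s, Z)` and the numerics alone.
[cite: Balaban1989LargeFieldI, (1.10)–(1.11) p.179, (1.19)–(1.21) pp.180–181, (1.89) p.198; Balaban1988Convergent, (2.1) p.254, p.265; Balaban1987RG1, (0.1) p.251] -/
theorem Zpp_stack_eq_zppOfRecordT
    {D : Setting189 (F.P P.K) (SU N) (MSField (F.P P.K) (SU N) × ((j : ℕ) → VecField (F.P P.K) j (EuclideanSpace ℝ (Fin (N ^ 2 - 1))))) (Pt (F.P P.K).d)}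
    (hD : D = D189OfHist ν P (sitOfHist ν A₁ M Nm P
      ((((((((σ.pinZres ν M g s N₀).pinSides ν g hs' k').pinXΩ4 s enl₁).pinOmegaPP s Nm enl₂).pinLambda s N₀ enl₃).pinDistAt kd).pinZpp s N₀ Nm (enlD F ν M P g)).pinCubes S) g s N₀ p₁) g)
    (hM : 0 < M) (hN2 : 2 ≤ N₀) (hNm : N₀ ≤ Nm) (hNk : N₀ ≤ k')
    (hdk : side (F.P P.K).L M k' ∣ (F.P P.K).sitesPerDir 0)
    (hdj : ∀ j, k' - Nm < j → j ≤ k' - N₀ → dCubeSide (F.P P.K).L M (RkOfRecord (F.P P.K).L ν.r (g j)) j ∣ (F.P P.K).sitesPerDir 0)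
    (hN₀eq : dCubeSide (F.P P.K).L M (RkOfRecord (F.P P.K).L ν.r (g (k' + 1 - N₀))) (k' + 1 - N₀) = side (F.P P.K).L M k')
    {j : ℕ} (hj : k' - Nm < j) :
    D.Zpp j = zppOfRecordT F ν M P g s N₀ σ.Z j := by
  rw [Zpp_stack Nm P σ s N₀ p₁ kd hs' S enl₁ enl₂ enl₃ hD]
  exact zppOfChain_eq_zppOfRecordT s N₀ σ.Z hM hN2 hNm hNk hdk hdj hN₀eq hj

/-- **`Z″_j ⊆ Z` ABOVE `h`** at the stack (p29's `zppT_subset`, hypothesis-free beyond §2's inputs) — module 13 had it by construction at the endpoints only.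
[cite: Balaban1989LargeFieldI, (1.11) p.179] -/
theorem Zpp_stack_subset_Z
    {D : Setting189 (F.P P.K) (SU N) (MSField (F.P P.K) (SU N) × ((j : ℕ) → VecField (F.P P.K) j (EuclideanSpace ℝ (Fin (N ^ 2 - 1))))) (Pt (F.P P.K).d)}
    (hD : D = D189OfHist ν P (sitOfHist ν A₁ M Nm P
      ((((((((σ.pinZres ν M g s N₀).pinSides ν g hs' k').pinXΩ4 s enl₁).pinOmegaPP s Nm enl₂).pinLambda s N₀ enl₃).pinDistAt kd).pinZpp s N₀ Nm (enlD F ν M P g)).pinCubes S) g s N₀ p₁) g)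
    (hM : 0 < M) (hN2 : 2 ≤ N₀) (hNm : N₀ ≤ Nm) (hNk : N₀ ≤ k')
    (hdk : side (F.P P.K).L M k' ∣ (F.P P.K).sitesPerDir 0)
    (hdj : ∀ j, k' - Nm < j → j ≤ k' - N₀ → dCubeSide (F.P P.K).L M (RkOfRecord (F.P P.K).L ν.r (g j)) j ∣ (F.P P.K).sitesPerDir 0)
    (hN₀eq : dCubeSide (F.P P.K).L M (RkOfRecord (F.P P.K).L ν.r (g (k' + 1 - N₀))) (k' + 1 - N₀) = side (F.P P.K).L M k')
    {j : ℕ} (hj : k' - Nm < j) : D.Zpp j ⊆ σ.Z := by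
  rw [Zpp_stack_eq_zppOfRecordT Nm P σ s N₀ p₁ kd hs' S enl₁ enl₂ enl₃ hD hM hN2 hNm hNk hdk hdj hN₀eq hj]
  exact zppOfRecordT_subset s N₀ σ.Z j

/-- ★★ **p29's CERTIFIED PROPERTIES TRANSFER BY NAME** under its located `Hypotheses` on the term's cover data (the chain `{Ω_j}` pulled back is [III]-(2.13)-admissible, the p. 177 (ii)
eight-layer margin inside `Z`, `Z` a union of `MR_k`-cube components of `Λ_kᶜ`, `N > N₀ ≥ 2`, the `N₀`-equation): at the stack, ABOVE `h`, the situation's `Z″_j` are NESTED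
(`Z″_j ⊆ Z″_{j+1}`), DISJOINT FROM `Ω_j` (`j ≤ k′`), and `Z ∖ Z″_{h+1} ⊆ Ω_h` (the chain with `Ω₀ = T_η`, `omegaT`) — print's (1.10)–(1.11) structure, now theorems about the situation's own regions; and the (1.12) domains
`{Ω″_j}` built from THESE `Z″_j` (r12's torus display `B15DeterminingSets.omegaPP`) form an ADMISSIBLE sequence on the cover (p29's `admissible_record`).
[cite: Balaban1989LargeFieldI, (1.10)–(1.12) p.179, p.177; Balaban1988Convergent, (2.1) p.254, (2.13) p.256] -/
theorem Zpp_stack_structure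
    {D : Setting189 (F.P P.K) (SU N) (MSField (F.P P.K) (SU N) × ((j : ℕ) → VecField (F.P P.K) j (EuclideanSpace ℝ (Fin (N ^ 2 - 1))))) (Pt (F.P P.K).d)}
    (hD : D = D189OfHist ν P (sitOfHist ν A₁ M Nm P
      ((((((((σ.pinZres ν M g s N₀).pinSides ν g hs' k').pinXΩ4 s enl₁).pinOmegaPP s Nm enl₂).pinLambda s N₀ enl₃).pinDistAt kd).pinZpp s N₀ Nm (enlD F ν M P g)).pinCubes S) g s N₀ p₁) g)
    (hM : 0 < M) (hN2 : 2 ≤ N₀) (hNm : N₀ ≤ Nm) (hNk : N₀ ≤ k')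
    (hdk : side (F.P P.K).L M k' ∣ (F.P P.K).sitesPerDir 0)
    (hdj : ∀ j, k' - Nm < j → j ≤ k' - N₀ → dCubeSide (F.P P.K).L M (RkOfRecord (F.P P.K).L ν.r (g j)) j ∣ (F.P P.K).sitesPerDir 0)
    (hN₀eq : dCubeSide (F.P P.K).L M (RkOfRecord (F.P P.K).L ν.r (g (k' + 1 - N₀))) (k' + 1 - N₀) = side (F.P P.K).L M k')
    (H : Hypotheses (F.P P.K).L M (k' - Nm) (k' - N₀) k' (fun j => RkOfRecord (F.P P.K).L ν.r (g j)) (pullSeq (omegaT F ν M g s)) (cover (F.P P.K) ⁻¹' σ.Z))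
    (hdj' : ∀ j, j ≤ k' - N₀ → side (F.P P.K).L M j * RkOfRecord (F.P P.K).L ν.r (g j) ∣ (F.P P.K).sitesPerDir 0) :
    (∀ j, k' - Nm < j → D.Zpp j ⊆ D.Zpp (j + 1)) ∧ (∀ j, k' - Nm < j → j ≤ k' → Disjoint (D.Zpp j) (D.Ω j)) ∧
      σ.Z \ D.Zpp (k' - Nm + 1) ⊆ omegaT F ν M g s (k' - Nm) ∧
      Admissible (F.P P.K).L M k' (pullSeq (B15DeterminingSets.omegaPP (omegaT F ν M g s) (zppOfRecordT F ν M P g s N₀ σ.Z) σ.Z (k' - Nm))) := by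
  have hΩ : D.Ω = omegaOfChain s := by subst hD; rfl
  have heq : ∀ j, k' - Nm < j → D.Zpp j = zppOfRecordT F ν M P g s N₀ σ.Z j :=
    fun j hj => Zpp_stack_eq_zppOfRecordT Nm P σ s N₀ p₁ kd hs' S enl₁ enl₂ enl₃ hD hM hN2 hNm hNk hdk hdj hN₀eq hj
  refine ⟨fun j hj => ?_, fun j hj hjk => ?_, ?_, admissible_record H hdk hdj'⟩
  · rw [heq j hj, heq (j + 1) (by omega)]
    exact zppT_mono (h := k' - Nm) H hj
  · rw [heq j hj, hΩ, ← omegaT_of_ne_zero F ν M g s (show j ≠ 0 by omega)]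
    exact zppT_disjoint (h := k' - Nm) H hjk
  · rw [heq (k' - Nm + 1) (by omega)]
    exact Z_diff_zppT_subset H

/-- Below `h` (`j + N ≤ k′`) the stack's `Z″_j` is module 13's `Λ_jᶜ ∩ Z` — print's (1.11) *«Z″_j = Z_j for j = h, h − 1, …, 1»* (`Z_j = Λ_jᶜ` read inside `Z`) — and NOT the torus
sequence of record there (p29's `ZppT` does not model the old regions). [cite: Balaban1989LargeFieldI, (1.11) p.179; Balaban1988Convergent, (2.3) p.255] -/
theorem Zpp_stack_low
    {D : Setting189 (F.P P.K) (SU N) (MSField (F.P P.K) (SU N) × ((j : ℕ) → VecField (F.P P.K) j (EuclideanSpace ℝ (Fin (N ^ 2 - 1))))) (Pt (F.P P.K).d)}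
    (hD : D = D189OfHist ν P (sitOfHist ν A₁ M Nm P
      ((((((((σ.pinZres ν M g s N₀).pinSides ν g hs' k').pinXΩ4 s enl₁).pinOmegaPP s Nm enl₂).pinLambda s N₀ enl₃).pinDistAt kd).pinZpp s N₀ Nm (enlD F ν M P g)).pinCubes S) g s N₀ p₁) g)
    {j : ℕ} (hj : j + Nm ≤ k') : D.Zpp j = (s.Λ j)ᶜ ∩ σ.Z := by
  rw [Zpp_stack Nm P σ s N₀ p₁ kd hs' S enl₁ enl₂ enl₃ hD]
  exact zppOfChain_low s N₀ Nm σ.Z _ _ hj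

end Stack

/-! ## §4. THE (1.89) DISPLAY AT THE `Zres`-PINNED STACK — module 18's theorems; EVERY region letter except `Z` an object of record -/

section Display

open B15 (Ineq180)
open B15.BasicStep (Claim189)
open B15.PrelimIntegrations (Ineq191 Ineq195)
open B15Chi124DetSets (E124)
open B15DeterminingSets (MSField)
open B15Claim189Assembly (Setting189 new189 chiPP dom half)
open B15Claim189PinsOfHistory (D189OfHist sitOfHist N0OfRecord₁₃)
open B15Claim189PrintedConditions (omegaOfChain)
open B15Claim189N0OfRecord (N0OfSeq)
open B15Claim189LambdaPin (enlD)
open B15Claim189ChiOmega4Pin (claim189_sitOfHist_ΛΩχ_of_flow claim189_sitOfHist₁₃_ΛΩχ_of_inInterval)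
open B8Eq17ClassAkV1 (plaqsOf)
open GaugeGroup (dist1)
open GaugeField (plaqHol)
open FlowStep (HBeta prefixOf BetaUpperH)
open FlowStepRuns (genSeq)
open B14FlowStep (SmallnessFor)

variable {F : T4Family} {N : ℕ} [NeZero N] {ν : Stage7Numerics} {A₁ : ℝ} {M : ℕ} (Nm : ℕ) (P : B12.RunParams) (σ : Sit189 F N P.K) {g : ℕ → ℝ} {k' : ℕ}
  (s : SeqOfRecord F ν M g P.K k') (p₁ : ℕ)

/-- ★★★ **(1.89) AT THE TERM'S FULLY PINNED STACK WITH THE INTERPOLATED `Z″_j` PINNED TO THE TORUS REGIONS OF RECORD** — module 18's `claim189_sitOfHist_ΛΩχ_of_flow` VERBATIM at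
`σ := σ.pinZres ν M g s N₀` (window-free; `N₀ := N0OfSeq L r g k′`): for the letters `D` of the stack `pinZres → pinSides → pinXΩ4 → pinOmegaPP → pinLambda → pinDistAt → pinZpp → pinCubes →
(term, levels, χ′, dev0)`, `Claim189 (new189 D) (chiPP D)`.  Now `D.Zpp j`, `j > h`, IS `ZppT … j` (§3, under its inputs), so the conclusion `χ″_k` ((1.24) at `n = N` over the regions
`Ω_m∖Ω_{m+1}`, `Ω^c_{k₀+1}∖Z″_k`, `Z″_{i+1}∖Z″_i`, `Z″_{h+1}∩Ω_h` of the configuration `U″_{k,Z}`) and the ℍ-domains of the leaves read the term's data `(s, Z)` and the numerics ONLY.  DISPLAYED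
inputs unchanged from module 18. [cite: Balaban1989LargeFieldI, (1.89) p.198, (1.10)–(1.11) p.179, (1.24) pp.181–182, pp.199–200; Balaban1988Convergent, (2.1) p.254, (2.5)–(2.8) pp.255–256, (2.17) p.257] -/
theorem claim189_sitOfHist_ΛΩχZ_of_flow (hM₂ : 0 < ν.M₂) (hM : 0 < M)
    {D : Setting189 (F.P P.K) (SU N) (MSField (F.P P.K) (SU N) × ((j : ℕ) → VecField (F.P P.K) j (EuclideanSpace ℝ (Fin (N ^ 2 - 1))))) (Pt (F.P P.K).d)}
    (hD : D = D189OfHist ν P (sitOfHist ν A₁ M Nm P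
      ((((((((σ.pinZres ν M g s (N0OfSeq (F.P P.K).L ν.r g k')).pinSides ν g (k' - Nm) k').pinXΩ4 s (enlD F ν M P g)).pinOmegaPP s Nm (enlD F ν M P g)).pinLambda s (N0OfSeq (F.P P.K).L ν.r g k') (enlD F ν M P g)).pinDistAt k').pinZpp s (N0OfSeq (F.P P.K).L ν.r g k') Nm (enlD F ν M P g)).pinCubes
        ((((((((σ.pinZres ν M g s (N0OfSeq (F.P P.K).L ν.r g k')).pinSides ν g (k' - Nm) k').pinXΩ4 s (enlD F ν M P g)).pinOmegaPP s Nm (enlD F ν M P g)).pinLambda s (N0OfSeq (F.P P.K).L ν.r g k') (enlD F ν M P g)).pinDistAt k').pinZpp s (N0OfSeq (F.P P.K).L ν.r g k') Nm (enlD F ν M P g)).OmTᶜ ∩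
          omegaOfChain s (k' - Nm))) g s (N0OfSeq (F.P P.K).L ν.r g k') p₁) g)
    (hlog : 1 < (Real.log (g k' ^ 2)⁻¹) ^ ν.r) (hNN : N0OfSeq (F.P P.K).L ν.r g k' ≤ Nm) (hNk : N0OfSeq (F.P P.K).L ν.r g k' ≤ k')
    (hβ0 : 0 ≤ σ.β) (hβ : σ.β ≤ 1 / 4) (hL₀ : 2 ≤ σ.L₀) (hL₀L : σ.L₀ ^ 2 ≤ ((F.P P.K).L : ℝ))
    (hB : 0 ≤ σ.O1 * σ.B₃ * σ.B₅) (hδ : 0 ≤ σ.δ)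
    (hN₀ : (2 + (121 / 120) ^ 2 * (σ.O1 * σ.B₃ * σ.B₅ * (M : ℝ) ^ 5)) * ((σ.L₀ ^ 2) ^ (N0OfSeq (F.P P.K).L ν.r g k' - 1))⁻¹ ≤ 1 / 4)
    (hMl : (121 / 120) ^ 2 * (σ.O1 * σ.B₃ * σ.B₅ * (M : ℝ) ^ 5) * Real.exp (-(4 * σ.δ * (M : ℝ))) ≤ 1 / 12)
    (hε0 : ∀ i, k' - Nm ≤ i → i ≤ k' → 0 ≤ epsOfRecord ν g i) (hε1 : ∀ i, k' - Nm ≤ i → i ≤ k' → epsOfRecord ν g i ≤ 1 / 10)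
    {β₀ : ℝ} (hβ₀0 : 0 ≤ β₀) (hβ₀ : β₀ ≤ 1 / 2)
    (hflow : ∀ j, k' - Nm ≤ j → j < k' → epsOfRecord ν g k' ≤ (1 + β₀) * Real.sqrt ((k' - j : ℕ) : ℝ) * epsOfRecord ν g j)
    (hgpos : 0 < g (k' + 1 - N0OfSeq (F.P P.K).L ν.r g k')) (hgstep : g (k' + 1 - N0OfSeq (F.P P.K).L ν.r g k') ≤ g (k' + 2 - N0OfSeq (F.P P.K).L ν.r g k'))
    (hgle : g (k' + 2 - N0OfSeq (F.P P.K).L ν.r g k') ≤ 1)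
    (hΛ : ((enlD F ν M P g 4 (k' + 1 - N0OfSeq (F.P P.K).L ν.r g k') (omegaOfChain s (k' + 1 - N0OfSeq (F.P P.K).L ν.r g k')))ᶜ ∩ σ.Z).Nonempty)
    (L91h : ∀ U, new189 D U → ∀ p ∈ plaqsOf (half D),
      Ineq191 (dist1 (plaqHol (D.Upp U) p)) (D.devV'' U p) D.α ((D.L ^ D.h)⁻¹) (D.ε D.h) (E124 D.ε D.L D.η D.k D.h))
    (L95 : ∀ U, new189 D U → ∀ p ∈ plaqsOf (half D),
      Ineq195 (D.devV'' U p) (dist1 (plaqHol (D.Uhalf U (D.boxOf p)) p)) D.α ((D.L ^ D.h)⁻¹) (D.ε D.h) (E124 D.ε D.L D.η D.k D.h))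
    (L91 : ∀ U, new189 D U → ∀ j, D.h ≤ j → j ≤ D.k → ∀ p ∈ plaqsOf (dom D j),
      Ineq191 (dist1 (plaqHol (D.Upp U) p)) (D.dev97 U p) D.α ((D.L ^ j)⁻¹) (D.ε j) (E124 D.ε D.L D.η D.k j))
    (L97 : ∀ U, new189 D U → ∀ j, D.h ≤ j → j ≤ D.k → ∀ p ∈ plaqsOf (dom D j),
      Ineq191 (D.dev97 U p) (D.dev0 U p) D.α ((D.L ^ j)⁻¹) (D.ε j) (E124 D.ε D.L D.η D.k j))
    (L80 : ∀ U, new189 D U → ∀ j, D.h ≤ j → j ≤ D.k → ∀ p ∈ plaqsOf (dom D j),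
      Ineq180 (D.dev0 U p) (D.ε D.k) D.η D.B₃ D.B₅ D.M D.δ (D.dist p) D.O1) :
    Claim189 (new189 D) (chiPP D) :=
  claim189_sitOfHist_ΛΩχ_of_flow Nm P (σ.pinZres ν M g s (N0OfSeq (F.P P.K).L ν.r g k')) s p₁ hM₂ hM hD hlog hNN hNk hβ0 hβ hL₀ hL₀L hB hδ hN₀ hMl hε0 hε1 hβ₀0 hβ₀ hflow
    hgpos hgstep hgle hΛ L91h L95 L91 L97 L80

variable {θ : Stage13Params F N} (s₁₃ : SeqOfRecord F θ.ν θ.τ9.M (gOfRecord₁₃ F N θ P) P.K k')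

/-- ★★★ **THE SAME AT RECORD 13, IN THE RUN'S (2.7)-SMALL WINDOW** — module 18's `claim189_sitOfHist₁₃_ΛΩχ_of_inInterval` VERBATIM at `σ := σ.pinZres θ.ν θ.τ9.M (gOfRecord₁₃ θ P) s N₀`
(`N₀ := N0OfRecord₁₃ θ P k′`): every region letter of the Stage-13 (1.89) situation except `Z` is an object of Record 13.  DISPLAYED: memory `N ≥ N₀(P)`, `N₀(P) ≤ k′`, residual numerics ∕
signs, `0 < M₂`, `0 < M`, print's second condition, the window (`S`, `hI`, `hup`, `hε10`, `hA₀`, `r ≥ 1`, one threshold `hwin`, `β₁₃ ≥ 0`), `Λ ≠ ∅`, the four ℍ-leaves and (1.80).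
[cite: Balaban1989LargeFieldI, (1.89) p.198, (1.10)–(1.11) p.179, pp.199–200; Balaban1988Convergent, (2.1) p.254, (2.4)–(2.8) pp.255–256, (2.17) p.257; Balaban1987RG1, (0.20) p.256, §1 p.264] -/
theorem claim189_sitOfHist₁₃_ΛΩχZ_of_inInterval (hM₂ : 0 < θ.ν.M₂) (hM : 0 < θ.τ9.M)
    {D : Setting189 (F.P P.K) (SU N) (MSField (F.P P.K) (SU N) × ((j : ℕ) → VecField (F.P P.K) j (EuclideanSpace ℝ (Fin (N ^ 2 - 1))))) (Pt (F.P P.K).d)}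
    (hD : D = D189OfHist θ.ν P (sitOfHist θ.ν θ.A₁ θ.τ9.M Nm P
      ((((((((σ.pinZres θ.ν θ.τ9.M (gOfRecord₁₃ F N θ P) s₁₃ (N0OfRecord₁₃ θ P k')).pinSides θ.ν (gOfRecord₁₃ F N θ P) (k' - Nm) k').pinXΩ4 s₁₃ (enlD F θ.ν θ.τ9.M P (gOfRecord₁₃ F N θ P))).pinOmegaPP s₁₃ Nm (enlD F θ.ν θ.τ9.M P (gOfRecord₁₃ F N θ P))).pinLambda s₁₃ (N0OfRecord₁₃ θ P k') (enlD F θ.ν θ.τ9.M P (gOfRecord₁₃ F N θ P))).pinDistAt k').pinZpp s₁₃ (N0OfRecord₁₃ θ P k') Nm (enlD F θ.ν θ.τ9.M P (gOfRecord₁₃ F N θ P))).pinCubes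
        ((((((((σ.pinZres θ.ν θ.τ9.M (gOfRecord₁₃ F N θ P) s₁₃ (N0OfRecord₁₃ θ P k')).pinSides θ.ν (gOfRecord₁₃ F N θ P) (k' - Nm) k').pinXΩ4 s₁₃ (enlD F θ.ν θ.τ9.M P (gOfRecord₁₃ F N θ P))).pinOmegaPP s₁₃ Nm (enlD F θ.ν θ.τ9.M P (gOfRecord₁₃ F N θ P))).pinLambda s₁₃ (N0OfRecord₁₃ θ P k') (enlD F θ.ν θ.τ9.M P (gOfRecord₁₃ F N θ P))).pinDistAt k').pinZpp s₁₃ (N0OfRecord₁₃ θ P k') Nm (enlD F θ.ν θ.τ9.M P (gOfRecord₁₃ F N θ P))).OmTᶜ ∩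
          omegaOfChain s₁₃ (k' - Nm))) (gOfRecord₁₃ F N θ P) s₁₃ (N0OfRecord₁₃ θ P k') p₁) (gOfRecord₁₃ F N θ P))
    (hr : 1 ≤ θ.ν.r) (hNN : (N0OfRecord₁₃ θ P k') ≤ Nm) (hNk : (N0OfRecord₁₃ θ P k') ≤ k')
    (hβ0 : 0 ≤ σ.β) (hβ : σ.β ≤ 1 / 4) (hL₀ : 2 ≤ σ.L₀) (hL₀L : σ.L₀ ^ 2 ≤ ((F.P P.K).L : ℝ))
    (hB : 0 ≤ σ.O1 * σ.B₃ * σ.B₅) (hδ : 0 ≤ σ.δ)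
    (hwin : 4 * (2 + (121 / 120) ^ 2 * (σ.O1 * σ.B₃ * σ.B₅ * (θ.τ9.M : ℝ) ^ 5))
      ≤ ((Real.log ((gOfRecord₁₃ F N θ P) k' ^ 2)⁻¹) ^ θ.ν.r) ^ (Real.log (σ.L₀ ^ 2) / Real.log ((F.P P.K).L : ℝ)))
    (hβhist : ∀ j, j < k' → 0 ≤ betaOfRecord₁₃ F N θ j (prefixOf (gOfRecord₁₃ F N θ P) j))
    (hMl : (121 / 120) ^ 2 * (σ.O1 * σ.B₃ * σ.B₅ * (θ.τ9.M : ℝ) ^ 5) * Real.exp (-(4 * σ.δ * (θ.τ9.M : ℝ))) ≤ 1 / 12)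
    (hA₀ : 0 ≤ θ.ν.A₀) {β' β₀ : ℝ} {L : ℕ} (S : SmallnessFor θ.γ β' β₀ L θ.ν.p₀) (hβ₀ : β₀ ≤ 1 / 2) (hε10 : θ.γ * p0Profile θ.ν.A₀ θ.ν.p₀ θ.γ ≤ 1 / 10)
    (hI : Step.InInterval θ.γ k' (gOfRecord₁₃ F N θ P)) (hup : BetaUpperH β' θ.γ (betaOfRecord₁₃ F N θ))
    (hΛ : (((enlD F θ.ν θ.τ9.M P (gOfRecord₁₃ F N θ P)) 4 (k' + 1 - (N0OfRecord₁₃ θ P k')) (omegaOfChain s₁₃ (k' + 1 - (N0OfRecord₁₃ θ P k'))))ᶜ ∩ σ.Z).Nonempty)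
    (L91h : ∀ U, new189 D U → ∀ p ∈ plaqsOf (half D),
      Ineq191 (dist1 (plaqHol (D.Upp U) p)) (D.devV'' U p) D.α ((D.L ^ D.h)⁻¹) (D.ε D.h) (E124 D.ε D.L D.η D.k D.h))
    (L95 : ∀ U, new189 D U → ∀ p ∈ plaqsOf (half D),
      Ineq195 (D.devV'' U p) (dist1 (plaqHol (D.Uhalf U (D.boxOf p)) p)) D.α ((D.L ^ D.h)⁻¹) (D.ε D.h) (E124 D.ε D.L D.η D.k D.h))
    (L91 : ∀ U, new189 D U → ∀ j, D.h ≤ j → j ≤ D.k → ∀ p ∈ plaqsOf (dom D j),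
      Ineq191 (dist1 (plaqHol (D.Upp U) p)) (D.dev97 U p) D.α ((D.L ^ j)⁻¹) (D.ε j) (E124 D.ε D.L D.η D.k j))
    (L97 : ∀ U, new189 D U → ∀ j, D.h ≤ j → j ≤ D.k → ∀ p ∈ plaqsOf (dom D j),
      Ineq191 (D.dev97 U p) (D.dev0 U p) D.α ((D.L ^ j)⁻¹) (D.ε j) (E124 D.ε D.L D.η D.k j))
    (L80 : ∀ U, new189 D U → ∀ j, D.h ≤ j → j ≤ D.k → ∀ p ∈ plaqsOf (dom D j),
      Ineq180 (D.dev0 U p) (D.ε D.k) D.η D.B₃ D.B₅ D.M D.δ (D.dist p) D.O1) :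
    Claim189 (new189 D) (chiPP D) :=
  claim189_sitOfHist₁₃_ΛΩχ_of_inInterval Nm P (σ.pinZres θ.ν θ.τ9.M (gOfRecord₁₃ F N θ P) s₁₃ (N0OfRecord₁₃ θ P k')) p₁ s₁₃ hM₂ hM hD hr hNN hNk hβ0 hβ hL₀ hL₀L hB hδ hwin hβhist hMl
    hA₀ S hβ₀ hε10 hI hup hΛ L91h L95 L91 L97 L80

end Display

end B15Claim189ZppOfRecordPin

end Literature.MathematicalPhysics.QuantumFieldTheory.Balaban1983to89
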